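import Summits.FinalStateConjecture.FinalStateConjecture.Theorems.ZeroEnergyKerrOrBombSymplecticDualOfTheBombDefs
import HarnessLib

/-!
# Route ZeroEnergyKerrOrBomb · crux `StationaryLimitReduction`, line `symplectic-dual-of-the-bomb`:
# stub `stub_moncriefTransversality` (THE LEVER) — audit, the `k = 0` case, and the conditional
# reduction to two named facts (local Moncrief duality; Corvino–Schoen/Chruściel–Delay deformations)

Stub 4 `stub_moncriefTransversality : Sig.stub_moncriefTransversality` of the checked skeleton
`Cruxes/StationaryLimitReduction/Lines/symplectic_dual_of_the_bomb.lean` (crux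
stmt-FinalStateConjecture-10021, `ZeroEnergyKerrOrBomb.StationaryLimitReduction := KerrOrBomb →
FinalStateConjecture`; vocabulary `ZeroEnergyKerrOrBombSymplecticDualOfTheBombDefs.lean`, §0):
for `k` detectors `(Aⱼ, Bⱼ)` at a KID-free point `x₀` (`AreDetectorsAt`) and every neighbourhood `V`
of `x₀`, a jointly smooth admissible `k`-parameter family `G` through `D`, supported in a compact
`K ⊆ V ∩ (chart source)`, with non-degenerate pairing matrix `det ω((A_l, B_l), ∂_j G|₀) ≠ 0`.

## What this file records (worker of lead a1, 2026-08-16)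

1. **Typed audit — the registered signature is NOT provable as typed** (work report
   `work/stubs/StubMoncriefTransversality.md`). (a) §0 `HasNoLocalKillingFieldNear 𝒟 x₀` opens with
   `∃ V ∋ x₀` and then quantifies over open `W ⊇ ι(V)`; the clause is NOT monotone in `V` and the
   witness `V = univ` makes it the GLOBAL condition "no Killing field near the whole Cauchy surface"
   (the sibling file `…StationaryLimitReductionStubDualModeEjection.lean`, §B,
   `hasNoLocalKillingFieldNear_of_global`), which holds at the centre `x₀` of an exactly FLAT ball of
   a globally KID-free admissible datum (Corvino-glued data, KIDs removed on the transition annulus à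
   la Beig–Chruściel–Schoen) — and there every admissible family `= D` off a compact `K` near `x₀` has
   a linearised-GAUGE tangent (second-order Taub / Brill–Deser obstruction: a compactly supported
   `h''` forces the positive linearised energy of `(h', k')` to vanish), which pairs to `0` with any
   compactly supported solution of the linearised constraints, e.g. the symmetric detector `(0, β)`,
   `β` a compactly supported TT tensor with `curl β (x₀) ≠ 0` (smooth; not a local Hessian, so not
   slice-tangent): `det = 0` for every `G`. So demanding symmetric detectors does NOT rescue the
   statement: the Killing hypothesis must be the GERM condition at `x₀` (`IsKIDFreeAt` below,
   `∃ V` ↦ `∀` connected `V`). (b) Detectors are arbitrary `BilinField`s: an antisymmetric `A₁ ≠ 0`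
   near `x₀` with `B₁ = 0` is never slice-tangent yet pairs to `0` with every family — kernel
   witnesses in the sibling file (`exists_antisymm_areDetectorsAt`,
   `det_pairingMatrix_eq_zero_of_antisymm`, `moncriefTransversality_false_of_kidFreePoint`: the
   registered text is false modulo ONE weakly Killing-free point). Corrected hypotheses: symmetric
   detectors AND `IsKIDFreeAt 𝒟 x₀`.
2. `stub_moncriefTransversality_zero`: the registered signature for `k = 0` (constant family,
   `K = ∅`, `det` of the empty matrix is `1`) — a typing certificate of every clause.
3. The two missing classical inputs, typed in the tree's vocabulary as `Prop`s
   (`LocalMoncriefDualityAt`, `LocalConstraintDeformationAt`, predicates of `(𝒟, x₀)`; interface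
   `IsLinearisedSolutionIn`), and
   the kernel-checked reduction `stub_moncriefTransversality_of_localDeformation` of the CORRECTED
   statement (extra antecedents: symmetric detectors, `IsKIDFreeAt 𝒟 x₀`) to them (two further
   antecedents): bookkeeping of neighbourhoods plus `det (ε • M) = εᵏ det M`.

Nothing here restates a route item; the registered stub itself is not touched (it stays `sorry` in the
skeleton, reported `stub-misstated` to the lead). No new axioms; named facts appear only as explicit
hypotheses of the reduction theorem.
-/

-- every `Summit.FinalStateConjecture.FinalStateConjecture.…` name repeats the summit = sub-problem segment (D-0017 layout)
set_option linter.dupNamespace false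
set_option maxSynthPendingDepth 3

noncomputable section

open scoped Manifold ContDiff Topology BigOperators
open Set Filter Bundle MeasureTheory Literature.Geometry.Lorentzian

namespace Summit.FinalStateConjecture.FinalStateConjecture.Theorems.SymplecticDualOfTheBomb

open Summit.FinalStateConjecture.FinalStateConjecture.Theorems.OneLockedExplosion

section Slice

variable {X : Type} [TopologicalSpace X] [ChartedSpace E3 X] [IsManifold (𝓡 3) ∞ X]

/-! ## §1 Corrected hypothesis: KID-freeness AT `x₀` (germ condition) -/

section Development

variable [T2Space X] [SecondCountableTopology X] [ConnectedSpace X] {D : InitialDataSet (𝓡 3) X}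

/-- **No Killing initial data AT `x₀`** (the germ condition; corrects §0 `HasNoLocalKillingFieldNear`,
whose leading `∃ V` is replaced by `∀` CONNECTED `V`): for every connected open `V ∋ x₀`, every
vector field which is smooth and Killing on an open set of the vacuum development containing `ι(V)`
vanishes on `ι(V)`. For small `V` (chart balls) this says that no neighbourhood of `ι(x₀)` carries a
non-zero Killing field, i.e. (Moncrief's correspondence KIDs ↔ Killing fields of the vacuum
development) no ball around `x₀` carries a non-trivial KID — the hypothesis of the Corvino–Schoen /
Chruściel–Delay submersion theorem on small balls around `x₀`; for large connected `V` it FOLLOWS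
from the small-`V` case (a Killing field vanishing on an open piece of a spacelike hypersurface has
vanishing `1`-jet there, hence vanishes on the connected component, which contains the connected
`ι(V)`). Connectedness of `V` matters: without it `V = B(x₀, r) ∪ B'` would forbid local Killing
fields near ANY far ball `B'` of the slice (e.g. in an exactly Kerr end of glued data), a global
genericity condition foreign to the line. [cite: ONeill1983, Ch. 9, Def. 9.22 and Prop. 9.25] -/
def IsKIDFreeAt (𝒟 : VacuumCauchyDevelopment D) (x₀ : X) : Prop :=
  haveI : 𝒟.metric.toPseudoRiemannianMetric.HasLeviCivita := 𝒟.metric.hasLeviCivita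
  ∀ V : Set X, IsOpen V → IsConnected V → x₀ ∈ V →
    ∀ (W : Set 𝒟.carrier), IsOpen W → 𝒟.embed '' V ⊆ W →
      ∀ ξ : (p : 𝒟.carrier) → TangentSpace (𝓡 4) p,
        ContMDiffOn (𝓡 4) ((𝓡 4).prod 𝓘(ℝ, E4)) ∞
          (fun p ↦ (TotalSpace.mk' E4 p (ξ p) : TangentBundle (𝓡 4) 𝒟.carrier)) W →
        (∀ p ∈ W, ∀ Y₀ Z₀ : TangentSpace (𝓡 4) p,
          𝒟.metric.val p (𝒟.metric.toPseudoRiemannianMetric.leviCivita ξ p Y₀) Z₀ +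
            𝒟.metric.val p Y₀ (𝒟.metric.toPseudoRiemannianMetric.leviCivita ξ p Z₀) = 0) →
        ∀ x ∈ V, ξ (𝒟.embed x) = 0

end Development

/-- `IsKIDFreeAt` strengthens §0 `HasNoLocalKillingFieldNear` (instantiate `V := univ`, connected since
`X` is); the converse fails (item 1 (a) of the module docstring). [folklore] -/
theorem hasNoLocalKillingFieldNear_of_isKIDFreeAt : ∀ (X : Type) [TopologicalSpace X] [ChartedSpace E3 X] [IsManifold (𝓡 3) ∞ X] [T2Space X] [SecondCountableTopology X] [ConnectedSpace X] {D : InitialDataSet (𝓡 3) X} (𝒟 : VacuumCauchyDevelopment D) (x₀ : X), IsKIDFreeAt 𝒟 x₀ → HasNoLocalKillingFieldNear 𝒟 x₀ :=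
  fun _ _ _ _ _ _ _ _ _ x₀ h ↦
    ⟨Set.univ, isOpen_univ, Set.mem_univ x₀, h Set.univ isOpen_univ isConnected_univ (Set.mem_univ x₀)⟩

/-! ## §2 The interface: compactly supported solutions of the LINEARISED vacuum constraints -/

/-- **`(a, b)` solves the linearised vacuum constraints at `D` and is supported in `K`**, typed
without a linearised-constraint OPERATOR: `(a, b)` is the tangent at `0` (`famTangentH/K`) of some
jointly smooth one-parameter family of data through `D`, equal to `D` off `K`, along which the
Hamiltonian and momentum constraint functions are stationary at `0` at every point
(`d/ds Φ(F s)(x)|₀ = DΦ_D(a, b)(x)` by the chain rule, whatever the family). For smooth symmetric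
`(a, b)` vanishing off a compact `K` this is `(a, b) ∈ ker DΦ_D` (take `F s = D + φ(s) (a, b)`,
`φ` a bounded squash with `φ'(0) = 1`, which keeps `h` positive definite). [cite: BartnikIsenberg2004, §2] -/
def IsLinearisedSolutionIn (D : InitialDataSet (𝓡 3) X) (a b : BilinField X) (K : Set X) : Prop :=
  ∃ F : EuclideanSpace ℝ (Fin 1) → InitialDataSet (𝓡 3) X,
    InitialDataSet.IsSmoothDataFamily 1 F ∧ F 0 = D ∧ IsSupportedIn D F K ∧
    famTangentH F 0 = a ∧ famTangentK F 0 = b ∧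
    ∀ x : X,
      HasDerivAt (fun s : ℝ ↦
        haveI := (F (EuclideanSpace.single 0 s)).metric.hasLeviCivita
        (F (EuclideanSpace.single 0 s)).hamiltonianConstraintFn x) 0 0 ∧
      ∀ v : TangentSpace (𝓡 3) x,
        HasDerivAt (fun s : ℝ ↦
          haveI := (F (EuclideanSpace.single 0 s)).metric.hasLeviCivita
          (F (EuclideanSpace.single 0 s)).momentumConstraintFn x v) 0 0

/-! ## §3 The two missing classical facts, as predicates of `(𝒟, x₀)` (explicit hypotheses of the
reduction; NOT proved here) -/

section Facts

variable [T2Space X] [SecondCountableTopology X] [ConnectedSpace X] {D : InitialDataSet (𝓡 3) X}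

/-- **Local Moncrief duality at `x₀`** (linear; Moncrief, J. Math. Phys. 16 (1975) 493, §II–III;
Fischer–Marsden–Moncrief, Ann. IHP 33 (1980) §1–2; the Hamiltonian reading "the constraints
generate the slice deformations", `ω(J∘DΦ*(N,Y), ·) = ∫ (N,Y)·DΦ(·)`, Wald App. E.2). For every
`k` and every `k` SYMMETRIC detector pairs `(A_l, B_l)`, smooth on an open `U ∋ x₀` inside the
chart source at `x₀`, no non-trivial real combination of which is locally a slice tangent at `x₀`
in the vacuum development `𝒟` (`IsLocalSliceTangentAt`), there are `k` solutions `(a_j, b_j)` of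
the linearised vacuum constraints supported in a compact `K ⊆ U` (`IsLinearisedSolutionIn`) whose
pairing matrix `(ω((A_l, B_l), (a_j, b_j)))_{jl}` (`chartPairing`, the ADM form read in the chart
at `x₀`) is invertible. Mechanism: `ω` is algebraically non-degenerate on symmetric pairs; on balls
`U_n ↑` around `x₀` the linearised constraint map on perturbations vanishing to all orders at
`∂U_n` has closed range with cokernel the KIDs of `U_n` (Chruściel–Delay, weighted spaces), so a
smooth symmetric pair `ω`-orthogonal to all compactly supported linearised solutions in `U_1` is
`J∘DΦ*(N, Y)` on `U_1` with `(N, Y)` smooth (injective symbol of the KID operator, elliptic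
regularity), i.e. the first variation of the Cauchy data along the slice deformation of `ι`
generated by `N ν + ι_* Y` — a local slice tangent at `x₀`; independence modulo local slice
tangents therefore gives `k` independent functionals on the compactly supported linearised
solutions near `x₀`, hence an invertible `k × k` minor. Not in the tree. [cite: Wald1984GR, Appendix E.2] -/
def LocalMoncriefDualityAt (𝒟 : VacuumCauchyDevelopment D) (x₀ : X) : Prop :=
  ∀ (k : ℕ) (A B : Fin k → BilinField X),
    (∀ j x (v w : TangentSpace (𝓡 3) x), A j x v w = A j x w v ∧ B j x v w = B j x w v) →
    (∀ a : Fin k → ℝ, a ≠ 0 →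
      ¬ IsLocalSliceTangentAt 𝒟 (fun x ↦ ∑ j, a j • A j x) (fun x ↦ ∑ j, a j • B j x) x₀) →
    ∀ U : Set X, IsOpen U → x₀ ∈ U → U ⊆ (extChartAt (𝓡 3) x₀).source →
      (∀ j, SmoothBilinOn (A j) U ∧ SmoothBilinOn (B j) U) →
      ∃ (a b : Fin k → BilinField X) (K : Set X), IsCompact K ∧ K ⊆ U ∧
        (∀ j, IsLinearisedSolutionIn D (a j) (b j) K) ∧
        (Matrix.of fun j l ↦ chartPairing D x₀ (A l) (B l) (a j) (b j)).det ≠ 0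

/-- **Local deformations of the vacuum constraints with prescribed compactly supported tangents
at the KID-free point `x₀`** (nonlinear; Corvino–Schoen, J. Differential Geom. 73 (2006) =
gr-qc/0301071, Thm. 2 and §3; Chruściel–Delay, Mém. SMF 94 (2003), Thm. 5.9 with Prop. 5.10 /
Cor. 5.11 — smooth, exponentially weighted version: solutions smooth up to the boundary, extending
by `D`). If `D` is admissible and `x₀` is free of Killing initial data in the germ sense
(`IsKIDFreeAt`), then inside every open `V ∋ x₀` there is an open `U ∋ x₀` (a small chart ball)
such that any `k` solutions `(a_j, b_j)` of the linearised vacuum constraints supported in a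
compact `K ⊆ U` (`IsLinearisedSolutionIn`) are, up to one common factor `ε ≠ 0`, the tangents
`∂_j G|₀ = ε (a_j, b_j)` of a jointly smooth `k`-parameter family `G` of ADMISSIBLE data with
`G 0 = D` and `G c = D` off a compact `K' ⊆ V` for every `c ∈ ℝᵏ`. Mechanism: on a smoothly
bounded ball `Ω ∋ x₀`, `K ⊆ Ω ⋐ U`, there are no KIDs (a KID on `Ω` is a Killing field on its
domain of dependence in `𝒟` — Moncrief 1975 — which `IsKIDFreeAt` kills), so the constraint map
on `D +` (perturbations vanishing to all orders at `∂Ω`) is a submersion at `D` and its zero set is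
a Banach manifold with tangent space the `Ω̄`-supported linearised solutions `∋ (a_j, b_j)`;
exponentiate the `k` directions (smooth dependence in every weighted Sobolev norm gives joint
smoothness in `(c, x)`), extend by `D` outside `Ω̄ =: K'`, and reach all `c ∈ ℝᵏ` by the squash
`c ↦ ε c / √(1 + |c|²)` (`ConstraintFamilies.lean`), which scales the tangents by `ε`; the vacuum
constraints hold, and completeness and the sole strongly asymptotically flat end (little-`o`
conditions at infinity) are untouched off the compact `K'`, so every member is admissible. Not in
the tree. [cite: ChruscielDelay2003, Thm. 5.9, Prop. 5.10, Cor. 5.11] -/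
def LocalConstraintDeformationAt (𝒟 : VacuumCauchyDevelopment D) (x₀ : X) : Prop :=
  D ∈ admissibleVacuumData X → IsKIDFreeAt 𝒟 x₀ → ∀ V : Set X, IsOpen V → x₀ ∈ V →
    ∃ U : Set X, IsOpen U ∧ x₀ ∈ U ∧ U ⊆ V ∧
      ∀ (k : ℕ) (a b : Fin k → BilinField X) (K : Set X), IsCompact K → K ⊆ U →
        (∀ j, IsLinearisedSolutionIn D (a j) (b j) K) →
        ∃ (G : EuclideanSpace ℝ (Fin k) → InitialDataSet (𝓡 3) X) (ε : ℝ), ε ≠ 0 ∧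
          InitialDataSet.IsSmoothDataFamily k G ∧ G 0 = D ∧
          (∀ c, G c ∈ admissibleVacuumData X) ∧
          (∃ K' : Set X, IsCompact K' ∧ K' ⊆ V ∧ IsSupportedIn D G K') ∧
          ∀ j, famTangentH G j = ε • a j ∧ famTangentK G j = ε • b j

end Facts

end Slice

/-! ## §4 Linearity of the pairing in the kick, and the pairing matrix of rescaled tangents -/

section Pairing

variable {X : Type} [TopologicalSpace X] [ChartedSpace E3 X] [IsManifold (𝓡 3) ∞ X]

/-- `⟨S, ε T⟩_h = ε ⟨S, T⟩_h`. [folklore] -/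
theorem symInner_smul_right (D : InitialDataSet (𝓡 3) X) (x : X) (ε : ℝ)
    (S T : TangentSpace (𝓡 3) x →L[ℝ] TangentSpace (𝓡 3) x →L[ℝ] ℝ) :
    symInner D x S (ε • T) = ε * symInner D x S T := by
  unfold symInner
  rw [← smul_eq_mul, ← map_smul]
  congr 1
  refine LinearMap.ext fun v ↦ ?_
  have h1 : (ε • T).toLinearMap₁₂.flip v = ε • T.toLinearMap₁₂.flip v := LinearMap.ext fun _ ↦ rfl
  simp only [LinearMap.comp_apply, LinearMap.smul_apply, h1, map_smul]

/-- `⟨ε S, T⟩_h = ε ⟨S, T⟩_h`. [folklore] -/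
theorem symInner_smul_left (D : InitialDataSet (𝓡 3) X) (x : X) (ε : ℝ)
    (S T : TangentSpace (𝓡 3) x →L[ℝ] TangentSpace (𝓡 3) x →L[ℝ] ℝ) :
    symInner D x (ε • S) T = ε * symInner D x S T := by
  unfold symInner
  rw [← smul_eq_mul, ← map_smul]
  congr 1
  refine LinearMap.ext fun v ↦ ?_
  have h1 : ∀ u, (ε • S).toLinearMap₁₂ u = ε • S.toLinearMap₁₂ u := fun u ↦ LinearMap.ext fun _ ↦ rfl
  simp only [LinearMap.comp_apply, LinearMap.smul_apply, h1, map_smul]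

/-- `tr_h (ε S) = ε tr_h S`. [folklore] -/
theorem hTrace_smul (D : InitialDataSet (𝓡 3) X) (x : X) (ε : ℝ)
    (S : TangentSpace (𝓡 3) x →L[ℝ] TangentSpace (𝓡 3) x →L[ℝ] ℝ) :
    hTrace D x (ε • S) = ε * hTrace D x S := by
  unfold hTrace PseudoRiemannianMetric.trace
  rw [← smul_eq_mul, ← map_smul]
  congr 1
  refine LinearMap.ext fun v ↦ ?_
  have h1 : (ε • S).toLinearMap₁₂ v = ε • S.toLinearMap₁₂ v := LinearMap.ext fun _ ↦ rfl
  simp only [LinearMap.comp_apply, LinearMap.smul_apply, h1, map_smul]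

/-- The symplectic density is linear in the kick: `ω((A,B), ε(a,b)) = ε ω((A,B),(a,b))`. [folklore] -/
theorem omegaDensity_smul (D : InitialDataSet (𝓡 3) X) (A B a b : BilinField X) (ε : ℝ) (x : X) :
    omegaDensity D A B (ε • a) (ε • b) x = ε * omegaDensity D A B a b x := by
  simp only [omegaDensity, Pi.smul_apply, symInner_smul_right, symInner_smul_left, hTrace_smul]
  ring

/-- The chart pairing is linear in the kick (no integrability needed: `∫ ε f = ε ∫ f`). [folklore] -/
theorem chartPairing_smul (D : InitialDataSet (𝓡 3) X) (x₀ : X) (A B a b : BilinField X) (ε : ℝ) :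
    chartPairing D x₀ A B (ε • a) (ε • b) = ε * chartPairing D x₀ A B a b := by
  unfold chartPairing
  rw [← integral_const_mul]
  refine integral_congr_ae (Filter.Eventually.of_forall fun y ↦ ?_)
  simp only [omegaDensity_smul]
  ring

/-- **Pairing matrix of a family with rescaled prescribed tangents**: if `∂_j G|₀ = ε (a_j, b_j)`
then `pairingMatrix D x₀ A B G = ε • (ω((A_l,B_l),(a_j,b_j)))_{jl}`. [folklore] -/
theorem pairingMatrix_eq_smul_of_tangent (D : InitialDataSet (𝓡 3) X) (x₀ : X) {k : ℕ}
    (A B a b : Fin k → BilinField X) (G : EuclideanSpace ℝ (Fin k) → InitialDataSet (𝓡 3) X)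
    (ε : ℝ) (htan : ∀ j, famTangentH G j = ε • a j ∧ famTangentK G j = ε • b j) :
    pairingMatrix D x₀ A B G = ε • Matrix.of fun j l ↦ chartPairing D x₀ (A l) (B l) (a j) (b j) := by
  ext j l
  simp only [pairingMatrix, Matrix.of_apply, Matrix.smul_apply, smul_eq_mul, (htan j).1, (htan j).2,
    chartPairing_smul]

end Pairing

/-! ## §5 The `k = 0` case of the registered signature, and the conditional reduction -/

/-- **Stub 4 for `k = 0` detectors** (junk check of the REGISTERED signature
`Sig.stub_moncriefTransversality`, certifying the typing of every clause): with no detector the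
constant family `G := fun _ ↦ D` is a jointly smooth `0`-parameter admissible family through `D`,
supported in `K := ∅ ⊆ V ∩ (chart source)`, and its `0 × 0` pairing matrix has determinant `1 ≠ 0`. [folklore] -/
theorem stub_moncriefTransversality_zero : ∀ (X : Type) [TopologicalSpace X] [ChartedSpace E3 X] [IsManifold (𝓡 3) ∞ X] [T2Space X] [SecondCountableTopology X] [ConnectedSpace X], ∀ D ∈ admissibleVacuumData X, ∀ (𝒟 : VacuumCauchyDevelopment D) (x₀ : X) (A B : Fin 0 → BilinField X), AreDetectorsAt 𝒟 x₀ A B → ∀ V : Set X, IsOpen V → x₀ ∈ V → ∃ G : EuclideanSpace ℝ (Fin 0) → InitialDataSet (𝓡 3) X, InitialDataSet.IsSmoothDataFamily 0 G ∧ G 0 = D ∧ (∀ c, G c ∈ admissibleVacuumData X) ∧ (∃ K : Set X, IsCompact K ∧ K ⊆ V ∧ K ⊆ (extChartAt (𝓡 3) x₀).source ∧ IsSupportedIn D G K) ∧ (pairingMatrix D x₀ A B G).det ≠ 0 := by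
  intro X _ _ _ _ _ _ D hD 𝒟 x₀ A B _ V _ _
  refine ⟨fun _ ↦ D, InitialDataSet.isSmoothDataFamily_const 0 D, rfl, fun _ ↦ hD,
    ⟨∅, isCompact_empty, empty_subset _, empty_subset _, fun _ _ _ ↦ ⟨rfl, rfl⟩⟩, ?_⟩
  rw [Matrix.det_isEmpty]
  exact one_ne_zero

/-- **The lever, conditionally: Moncrief transversality at a KID-free point from local Moncrief
duality and the local deformation manifold.** Under `LocalConstraintDeformationAt 𝒟 x₀` and
`LocalMoncriefDualityAt 𝒟 x₀`, for SYMMETRIC detectors at `x₀` (`AreDetectorsAt`: smooth near `x₀`, no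
combination locally slice-tangent) with `x₀` KID-free in the germ sense (`IsKIDFreeAt`), and every
open `V ∋ x₀`: a jointly smooth admissible `k`-parameter family through `D`, supported in a compact
`K ⊆ V ∩ (chart source at x₀)`, with non-degenerate pairing matrix. Proof: shrink `V` to
`V' := V ∩ (smoothness neighbourhood) ∩ (chart source)`; the deformation fact supplies a good domain
`U ⊆ V'` around `x₀`; duality on `U` supplies `k` compactly supported linearised solutions with
invertible pairing matrix `M`; the deformation fact exponentiates them with tangents `ε (a_j, b_j)`,
`ε ≠ 0`; the pairing matrix of the family is `ε • M`, `det (ε • M) = εᵏ det M ≠ 0`. This is the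
corrected statement of the registered stub (two extra antecedents), reduced to the two named facts at `(𝒟, x₀)`. [cite: Wald1984GR, Appendix E.2] -/
theorem stub_moncriefTransversality_of_localDeformation : ∀ (X : Type) [TopologicalSpace X] [ChartedSpace E3 X] [IsManifold (𝓡 3) ∞ X] [T2Space X] [SecondCountableTopology X] [ConnectedSpace X], ∀ D ∈ admissibleVacuumData X, ∀ (𝒟 : VacuumCauchyDevelopment D) (x₀ : X) (k : ℕ) (A B : Fin k → BilinField X), AreDetectorsAt 𝒟 x₀ A B → (∀ j x (v w : TangentSpace (𝓡 3) x), A j x v w = A j x w v ∧ B j x v w = B j x w v) → IsKIDFreeAt 𝒟 x₀ → LocalConstraintDeformationAt 𝒟 x₀ → LocalMoncriefDualityAt 𝒟 x₀ → ∀ V : Set X, IsOpen V → x₀ ∈ V → ∃ G : EuclideanSpace ℝ (Fin k) → InitialDataSet (𝓡 3) X, InitialDataSet.IsSmoothDataFamily k G ∧ G 0 = D ∧ (∀ c, G c ∈ admissibleVacuumData X) ∧ (∃ K : Set X, IsCompact K ∧ K ⊆ V ∧ K ⊆ (extChartAt (𝓡 3) x₀).source ∧ IsSupportedIn D G K) ∧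 (pairingMatrix D x₀ A B G).det ≠ 0 := by
  intro X _ _ _ _ _ _ D hD 𝒟 x₀ k A B hdet hsymm hKID hDef hDual V hV hxV
  obtain ⟨-, ⟨Vs, hVs, hxVs, hsmooth⟩, hng⟩ := hdet
  -- shrink to `V' := V ∩ Vs ∩ (chart source)`
  set V' : Set X := V ∩ Vs ∩ (extChartAt (𝓡 3) x₀).source with hV'
  have hV'o : IsOpen V' := (hV.inter hVs).inter (isOpen_extChartAt_source x₀)
  have hxV' : x₀ ∈ V' := ⟨⟨hxV, hxVs⟩, mem_extChartAt_source x₀⟩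
  -- the deformation fact: a good domain `U ⊆ V'` around `x₀`
  obtain ⟨U, hU, hxU, hUV', hdom⟩ := hDef hD hKID V' hV'o hxV'
  have hUsrc : U ⊆ (extChartAt (𝓡 3) x₀).source := fun x hx ↦ (hUV' hx).2
  have hUsm : ∀ j, SmoothBilinOn (A j) U ∧ SmoothBilinOn (B j) U := fun j ↦
    ⟨(hsmooth j).1.mono fun x hx ↦ (hUV' hx).1.2, (hsmooth j).2.mono fun x hx ↦ (hUV' hx).1.2⟩
  -- local Moncrief duality on `U`: `k` compactly supported linearised solutions, invertible pairing
  obtain ⟨a, b, K, hKc, hKU, hlin, hdetM⟩ := hDual k A B hsymm hng U hU hxU hUsrc hUsm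
  -- exponentiate them
  obtain ⟨G, ε, hε, hG, hG0, hGadm, ⟨K', hK'c, hK'V', hsupp⟩, htan⟩ := hdom k a b K hKc hKU hlin
  refine ⟨G, hG, hG0, hGadm, ⟨K', hK'c, fun x hx ↦ (hK'V' hx).1.1, fun x hx ↦ (hK'V' hx).2, hsupp⟩, ?_⟩
  rw [pairingMatrix_eq_smul_of_tangent D x₀ A B a b G ε htan, Matrix.det_smul, Fintype.card_fin]
  exact mul_ne_zero (pow_ne_zero k hε) hdetM

end Summit.FinalStateConjecture.FinalStateConjecture.Theorems.SymplecticDualOfTheBomb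

end
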